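import Summits.HodgeConjecture.HodgeCM.PerL34.S5QautSeesawArch_2

/-! PORT of `HodgeCM/PerL34/S5QautSeesawArch.lean` (HodgeCMPerL run 82) — part 3: continuation of `Summits.HodgeConjecture.HodgeCM.PerL34.S5QautSeesawArch_2` (split at a top-level declaration boundary by port_pkg.py; scope re-opened below; declarations unchanged). -/

-- port_pkg: scope re-opened for this part (file-level context, then the namespace/section stack open at the cut)
set_option autoImplicit false
noncomputable section
open MeasureTheory Matrix MvPolynomial
open HodgeCM.Prior.Perl34File
open HodgeCM.PerL34.Qaut (pr prL prL_apply wedge)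
open HodgeCM.PerL34.P43KTypesU2 (Jplus Jplus_apply_coe fockRep fockRep_apply jplusSubmodule mem_jplusSubmodule
  isWeightedHomogeneous_substHom)
open HodgeCM.PerL34.QautFock (pPlusMat continuous_pPlusMat isUnit_det_pPlusMat formOf QautFockBridge
  N19g_core_of_fockBridge open_thetaReal34_of_fockBridges)
open HodgeCM.PerL34.Seesaw
open HodgeCM.PerL34.QautSeesaw (QautSeesawBridge thetaPeriod_sum_tmul N19g_core_of_seesawBridge
  open_thetaReal34_of_seesawBridges)
namespace HodgeCM
namespace PerL34
namespace QautSeesawArch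
variable {U : Universe} (T : U.ThetaModel)
variable {L : CMField} {ι₁ : L →+* ℂ} (V : HermSpace3 L ι₁) (c : SeesawCtx L)
variable (D : Perl34.TorusData (T.core V c)) (k l : Fin 4)
namespace QautSeesawArchBridge
variable {T V c D k l}
variable (R : QautSeesawArchBridge T V c D k l)
/-- **The constructor: F3's record from the widened one** — `Adm_j` DEFINED, `emb_j`, `thetaJ_j` restricted, `ϑ_pr`
DERIVED. -/
def toSeesawBridge : QautSeesawBridge T V c D k l where
  K := R.K
  μ := R.μ
  C := R.C
  σ := R.σ
  σ_cont := R.σ_cont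
  κ := R.κ
  κ_cont := R.κ_cont
  ρ_diag := R.ρ_diag
  ρ_antidiag := R.ρ_antidiag
  k₀ := R.k₀
  d₀ := R.d₀
  κ_k₀ := R.κ_k₀
  d₀_pow_ne_one := R.d₀_pow_ne_one
  toHG := R.toHG
  DS := R.DS
  ν₁ := R.ν₁
  ν₂ := R.ν₂
  omegaSub := R.omegaSub
  evSub := R.evSub
  evalTmul := R.evalTmul
  restrictTmul := R.restrictTmul
  absSummable₁ := R.absSummable₁
  absSummable₂ := R.absSummable₂
  evalC := R.evalC
  evalC_injective := R.evalC_injective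
  ract := R.ract
  evalC_sigma := R.evalC_sigma
  ωK₁ := R.ωK₁
  ωK₂ := R.ωK₂
  omega_ract₁ := R.omega_ract₁
  omega_ract₂ := R.omega_ract₂
  ch₁ := R.ch₁
  ch₂ := R.ch₂
  Away₁ := R.Away₁
  Away₂ := R.Away₂
  Adm₁ _ a := R.Adm₁ a
  Adm₂ _ a := R.Adm₂ a
  emb₁ a p := R.embH₁ a p
  emb₂ a p := R.embH₂ a p
  emb_equiv₁ _ a ha x p := by
    rw [Jplus_apply_coe]
    exact R.emb_equiv₁ a ha x p
  emb_equiv₂ _ a ha x p := by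
    rw [Jplus_apply_coe]
    exact R.emb_equiv₂ a ha x p
  integrable₁ χ a _ p g := R.integrable₁ χ a p g
  integrable₂ χ a _ p g := R.integrable₂ χ a p g
  thetaJ₁ := R.thetaJ₁
  thetaJ₂ := R.thetaJ₂
  evalC_thetaJ₁ χ a p := R.evalC_thetaH₁ χ a p
  evalC_thetaJ₂ χ a p := R.evalC_thetaH₂ χ a p
  periodC := R.periodC
  evalC_periodC := R.evalC_periodC
  wedge_mem χ hχ a₁ ha₁ a₂ ha₂ := R.wedge_mem χ hχ a₁ ha₁ a₂ ha₂
  P := R.P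
  dense := R.dense
  ϑ_pr := R.ϑ_pr_adm

/-- (Ported verbatim from the HodgeCMPerL package; no docstring in the source.) -/
theorem toSeesawBridge_P : R.toSeesawBridge.P = R.P := rfl

end QautSeesawArchBridge

variable {T V c D k l}

/-- **Seam S5, `N19g` half, from the widened record:** everything F3 discharged PLUS ll. 362–364 is kernel. -/
theorem N19g_core_of_archBridge (R : QautSeesawArchBridge T V c D k l) : N19g_core T V c D k l :=
  N19g_core_of_seesawBridge R.toSeesawBridge

/-- F3's record follows. -/
theorem nonempty_seesawBridge_of_archBridge (R : QautSeesawArchBridge T V c D k l) :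
    Nonempty (QautSeesawBridge T V c D k l) :=
  ⟨R.toSeesawBridge⟩

variable (T) in
/-- **pv08's adapter with its hypothesis DISCHARGED from the widened records.** -/
theorem open_thetaReal34_of_archBridges
    (hR : ∀ {L : CMField} {ι₁ : L →+* ℂ} (V : HermSpace3 L ι₁) (c : SeesawCtx L), T.GoodCtx ι₁ c →
      Nonempty (QautSeesawArchBridge T V c (T.t34 V c) 2 3)) :
    T.Open_thetaReal34 :=
  open_thetaReal34_of_seesawBridges T fun V c hc => (hR V c hc).elim fun R => ⟨R.toSeesawBridge⟩

/-! ## §5. STRENGTH (census): the widened record is CONSERVATIVE over the leaf `N19g_core` -/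

namespace QautSeesawArchBridge

/-- **Junk widening** of an F3 record whose `K_∞`-equivariance is stated for all away data and whose admissibility
predicates hold identically (F4's junk record is such): NO real place away from `ι₁` (`Pl := PEmpty`), vacuum twist
`kW_j := -1` (so the allowed exponent at `ι₁` is `0`), trivial circles, and the Fock factor read through `projJ` (§2:
`projJ_fockRep`, `projJ_harmCircle`, `projJ_coe` make this type-honest). -/
def ofSeesawBridge (R : QautSeesawBridge T V c D k l)
    (hE₁ : ∀ a (x : R.K) (p : jplusSubmodule), R.ωK₁ x (R.emb₁ a p) = R.emb₁ a (Jplus (R.κ x) p))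
    (hE₂ : ∀ a (x : R.K) (p : jplusSubmodule), R.ωK₂ x (R.emb₂ a p) = R.emb₂ a (Jplus (R.κ x) p))
    (hA₁ : ∀ χ a, R.Adm₁ χ a) (hA₂ : ∀ χ a, R.Adm₂ χ a) : QautSeesawArchBridge T V c D k l where
  K := R.K
  μ := R.μ
  C := R.C
  σ := R.σ
  σ_cont := R.σ_cont
  κ := R.κ
  κ_cont := R.κ_cont
  ρ_diag := R.ρ_diag
  ρ_antidiag := R.ρ_antidiag
  k₀ := R.k₀
  d₀ := R.d₀
  κ_k₀ := R.κ_k₀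
  d₀_pow_ne_one := R.d₀_pow_ne_one
  toHG := R.toHG
  DS := R.DS
  ν₁ := R.ν₁
  ν₂ := R.ν₂
  omegaSub := R.omegaSub
  evSub := R.evSub
  evalTmul := R.evalTmul
  restrictTmul := R.restrictTmul
  absSummable₁ := R.absSummable₁
  absSummable₂ := R.absSummable₂
  evalC := R.evalC
  evalC_injective := R.evalC_injective
  ract := R.ract
  evalC_sigma := R.evalC_sigma
  ωK₁ := R.ωK₁
  ωK₂ := R.ωK₂
  omega_ract₁ := R.omega_ract₁
  omega_ract₂ := R.omega_ract₂
  ch₁ := R.ch₁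
  ch₂ := R.ch₂
  Pl := PEmpty
  e₁ b := nomatch b
  e₂ b := nomatch b
  kW₁ := -1
  kW₂ := -1
  Away₁ := R.Away₁
  Away₂ := R.Away₂
  wt₁ b := nomatch b
  wt₂ b := nomatch b
  embH₁ a p := R.emb₁ a (projJ p)
  embH₂ a p := R.emb₂ a (projJ p)
  emb_equiv₁ a _ x p := by
    show R.ωK₁ x (R.emb₁ a (projJ p)) = R.emb₁ a (projJ (fockRep (R.κ x) p))
    rw [projJ_fockRep]
    exact hE₁ a x (projJ p)
  emb_equiv₂ a _ x p := by
    show R.ωK₂ x (R.emb₂ a (projJ p)) = R.emb₂ a (projJ (fockRep (R.κ x) p))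
    rw [projJ_fockRep]
    exact hE₂ a x (projJ p)
  integrable₁ χ a p g := R.integrable₁ χ a (hA₁ χ a) (projJ p) g
  integrable₂ χ a p g := R.integrable₂ χ a (hA₂ χ a) (projJ p) g
  thetaH₁ χ a := (R.thetaJ₁ χ a).comp projJ
  thetaH₂ χ a := (R.thetaJ₂ χ a).comp projJ
  evalC_thetaH₁ χ a p := R.evalC_thetaJ₁ χ a (projJ p)
  evalC_thetaH₂ χ a p := R.evalC_thetaJ₂ χ a (projJ p)
  periodC := R.periodC
  evalC_periodC := R.evalC_periodC
  rι₁ _ u := u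
  rι₂ _ u := u
  r₁ b := nomatch b
  r₂ b := nomatch b
  period_rι₁ _ _ _ _ := rfl
  period_rι₂ _ _ _ _ := rfl
  period_r₁ b := nomatch b
  period_r₂ b := nomatch b
  ch_rι₁ χ _ z u := by
    show R.ch₁ χ u = R.ch₁ χ u * (z : ℂ) ^ (-(1 + (-1 : ℤ)))
    norm_num
  ch_rι₂ χ _ z u := by
    show R.ch₂ χ u = R.ch₂ χ u * (z : ℂ) ^ (-(1 + (-1 : ℤ)))
    norm_num
  ch_r₁ _ _ b := nomatch b
  ch_r₂ _ _ b := nomatch b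
  omega_rι₁ z g u a p := by
    show R.DS.ω₁ g u (R.emb₁ a (projJ p)) = R.DS.ω₁ g u (R.emb₁ a (projJ (Fock.harmCircle (-1) z p)))
    rw [projJ_harmCircle]
    norm_num
  omega_rι₂ z g u a p := by
    show R.DS.ω₂ g u (R.emb₂ a (projJ p)) = R.DS.ω₂ g u (R.emb₂ a (projJ (Fock.harmCircle (-1) z p)))
    rw [projJ_harmCircle]
    norm_num
  omega_r₁ b := nomatch b
  omega_r₂ b := nomatch b
  wedge_mem χ hχ a₁ _ a₂ _ := by
    have h₁ : ((R.thetaJ₁ χ a₁).comp projJ).comp jplusSubmodule.subtype = R.thetaJ₁ χ a₁ :=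
      LinearMap.ext fun p => by
        show R.thetaJ₁ χ a₁ (projJ (p : Fock.HarmModel)) = R.thetaJ₁ χ a₁ p
        rw [projJ_coe]
    have h₂ : ((R.thetaJ₂ χ a₂).comp projJ).comp jplusSubmodule.subtype = R.thetaJ₂ χ a₂ :=
      LinearMap.ext fun p => by
        show R.thetaJ₂ χ a₂ (projJ (p : Fock.HarmModel)) = R.thetaJ₂ χ a₂ p
        rw [projJ_coe]
    show R.toHG (wedge (formOf (((R.thetaJ₁ χ a₁).comp projJ).comp jplusSubmodule.subtype))
      (formOf (((R.thetaJ₂ χ a₂).comp projJ).comp jplusSubmodule.subtype))) ∈ T.wedgeSet V c k l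
    rw [h₁, h₂]
    exact R.wedge_mem χ hχ a₁ (hA₁ χ a₁) a₂ (hA₂ χ a₂)
  P := R.P
  dense := R.dense
  ϑ_pr χ hχ Φ hΦ := by
    obtain ⟨n, a₁, a₂, p₁, p₂, _, hϑ⟩ := R.ϑ_pr χ hχ Φ hΦ
    refine ⟨n, a₁, a₂, fun i => (p₁ i : Fock.HarmModel), fun i => (p₂ i : Fock.HarmModel), ?_⟩
    show D.ϑ χ Φ = R.toHG (pr R.μ (pPlusMat.comp R.κ) R.σ (R.periodC χ
      (∑ i, R.DS.tmul (R.emb₁ (a₁ i) (projJ (p₁ i : Fock.HarmModel))) (R.emb₂ (a₂ i) (projJ (p₂ i : Fock.HarmModel))))))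
    simp only [projJ_coe]
    exact hϑ

end QautSeesawArchBridge

variable (T V c D k l) in
/-- **The junk widened record over the leaf** (F4's junk F3 record, widened). -/
def archBridge_of_core (hcore : N19g_core T V c D k l) : QautSeesawArchBridge T V c D k l :=
  QautSeesawArchBridge.ofSeesawBridge (QautSeesaw.Conservative.seesawBridge_of_core T V c D k l hcore)
    (fun a x p => by
      show S5ConservativeQaut.σ _ x (QautFock.ψOf (S5ConservativeQaut.form _ (S5ConservativeQaut.ind _ a) 0) p) =
        QautFock.ψOf (S5ConservativeQaut.form _ (S5ConservativeQaut.ind _ a) 0) (Jplus (QautFock.Conservative.κ x) p)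
      exact QautFock.ψOf_equivariant _ _ _ (QautFock.Conservative.isForm_form_κ _ _ _) x p)
    (fun _ x p => by
      show S5ConservativeQaut.σ _ x (QautFock.ψOf (S5ConservativeQaut.form _ 1 1) p) =
        QautFock.ψOf (S5ConservativeQaut.form _ 1 1) (Jplus (QautFock.Conservative.κ x) p)
      exact QautFock.ψOf_equivariant _ _ _ (QautFock.Conservative.isForm_form_κ _ _ _) x p)
    (fun _ _ => trivial) (fun _ _ => trivial)

variable (T V c D k l) in
/-- **CONSERVATIVITY of the widened S5 record**: in logical strength `QautSeesawArchBridge` is exactly the leaf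
`N19g_core` (→ : `N19g_core_of_archBridge`; ← : the junk widening above). -/
theorem nonempty_archBridge_iff : Nonempty (QautSeesawArchBridge T V c D k l) ↔ N19g_core T V c D k l :=
  ⟨fun ⟨R⟩ => N19g_core_of_archBridge R, fun h => ⟨archBridge_of_core T V c D k l h⟩⟩

variable (T V c D k l) in
/-- … hence exactly F3's record (pv08-g5 `S5QautSeesawConservative.nonempty_seesawBridge_iff`). -/
theorem nonempty_archBridge_iff_seesawBridge :
    Nonempty (QautSeesawArchBridge T V c D k l) ↔ Nonempty (QautSeesawBridge T V c D k l) :=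
  (nonempty_archBridge_iff T V c D k l).trans (QautSeesaw.Conservative.nonempty_seesawBridge_iff T V c D k l).symm

variable (T) in
/-- **Binder-level form**: the hypothesis of `open_thetaReal34_of_archBridges` is EQUIVALENT to the model-level leaf
binder `hcore` of `OpenInputsN19.open_thetaReal34_of_core`. -/
theorem archBridges_iff_core :
    (∀ {L : CMField} {ι₁ : L →+* ℂ} (V : HermSpace3 L ι₁) (c : SeesawCtx L), T.GoodCtx ι₁ c →
      Nonempty (QautSeesawArchBridge T V c (T.t34 V c) 2 3)) ↔
    (∀ {L : CMField} {ι₁ : L →+* ℂ} (V : HermSpace3 L ι₁) (c : SeesawCtx L), T.GoodCtx ι₁ c →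
      N19g_core T V c (T.t34 V c) 2 3) :=
  ⟨fun h _ _ V c hc => (nonempty_archBridge_iff T V c _ 2 3).mp (h V c hc),
   fun h _ _ V c hc => (nonempty_archBridge_iff T V c _ 2 3).mpr (h V c hc)⟩

end QautSeesawArch
end PerL34
end HodgeCM

end
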